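import Literature.MathematicalPhysics.QuantumFieldTheory.Balaban1983to89.B12Decay510Gauge
import Literature.MathematicalPhysics.QuantumFieldTheory.Balaban1983to89.B12Eq435SecondVariation
import Summits.QuantumFields.YangMills.Theorems.BalabanUVNodesPortS1Sect4Ward

/-!
# PORT PT-H (slot 8, closer-designate in helper mode) — THE DECAY ROAD OVER THE ROW PREDICATES: (1.19)-mould ∧ chart on a (4.4)-domain ∧ Ward rows ∧
# gauge-currency responses ∧ leaves ∧ response link ∧ colour-scalar ∧ (1.21) ⟹ (5.10) FOR THE LIMIT KERNEL `plimOf … 0 1` with δ₁ = ½ min{δ₀, κM⁻¹}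

Cell `ym-nodeO-ideate` ∕ `ym-balaban-port`, porter seat `ymgap-nodeO-port-PTC-1` (gen 2).  The slot-8 text is UNSIGNED (director-ym №471 (2): SIGNING HOLD until CRIT-1
rules Q-8 between T-3 `PortPiHoloUniformH` cf358f9c and T-3′ `PortPiDecayUniformH` 9e27aaca); this file proves NEITHER text.  It proves the CORE of the typer's «porter's road»
once, over the ROW PREDICATES as separate hypotheses (the same binders both texts carry), so that the eventual closer is packaging:
★★ `decay510_plimOf_of_rows` : `FormatPlusG` (the (1.19)-mould at ONE real history, 27930⁸'s consequent shape) → `Chart44D` → chart equivariance ∧ «G semisimple» ∧ (A3)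
cut-locality → `Response9D` → leaves + window isometry → RowL (`ιe n 0 = 0`, `C²`, `R.Gk = Dιe(0) δ`) → RowS (colour-scalar at `a★`) → `Limit121` →
`B12Sec2to5.Decay510 (plimOf F fam ρ bV k v 0 1) (16·E₀·C₉²·e^{δ₁Mg c₁}·K₀·K₁) (B12Decay510.delta1 δ₀ κ Mg)` — the constant depends on the LETTERS only.
ROAD (typer memo `TYPER-T3-SHAPE-v1.md`, CRIT-1 Q-T3-3): per volume `n`, with `F_X := 𝐄ₙ(X, ·) ∘ χ_X` and `hₙ(X, y) := cutTo (R.cX n X) (R.Gk n y)`: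
(i) (4.14) for the pieces from (1.19) + RowC (`BalabanUVNodesPortS1.ward414_of_gaugeInv119_chart44D`); (ii) ★ `pvolOf_eq_sum_re_mixedDeriv` — (4.37) at the real history:
`pvolOf … (K n) 0 1 z = Σ_X Re ∂²F_X[hₙ(X, e 1 0), hₙ(X, e 0 z)]` (the bridge `B12Eq435SecondVariation.ofReal_fderiv_fderiv_eq_sum_mixedDeriv_of_repr` + RowL + RowS + the (A3)∕(1.7) cut
through `Beta.RemainderLocality.mixedDeriv_comp_clm`); (iii) the per-volume (5.10) bound `B12Decay510Gauge.abs_twoPoint_le_of_gauge` (bidisc Cauchy in gauge currency, `hh` =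
(R1ᴰ) with `B_h := C₉`); (iv) window isometry at `(μ, ν) = (1, 0)` and `B12Decay510.decay510_of_tendsto` along `Limit121` at `(0, 1, z)` — no single-window-map is needed.

HONEST FRAMING.  A CONDITIONAL theorem over NAMED row predicates (every row a hypothesis, none asserted); nothing of Bałaban's estimates is ported or discharged; PT-H's text
UNSIGNED, slot 8 NOT open; 27930⁸ ∕ 26648 ∕ 27931⁷′ UNSIGNED; K0⁷ OPEN; NODE O 0∕1; COUNT 8∕28 · K 1∕4 UNMOVED; finite `𝕋⁴_{L^K}` at fixed ε — NOT continuum ∕ OS ∕ Clay;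
**the Yang–Mills mass gap (Clay) is NOT proved by any of this.**  No `def`, `instance`, `notation`, `sorry`; axioms `{propext, Classical.choice, Quot.sound}`.
-/

noncomputable section

open Filter Topology

namespace Summit.QuantumFields.YangMills.Theorems.PortH

open Literature.MathematicalPhysics.QuantumFieldTheory.Balaban1983to89
open Literature.MathematicalPhysics.QuantumFieldTheory.Balaban1983to89.Node00 (TermFamily1 siteOfInt)
open Literature.MathematicalPhysics.QuantumFieldTheory.Balaban1983to89.T4Continuum (T4Family)
open Literature.MathematicalPhysics.QuantumFieldTheory.Balaban1983to89.B12FormatPlus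
open Literature.MathematicalPhysics.QuantumFieldTheory.Balaban1983to89.B12Decay510 (GeomLeaf CubeSumLeaf TreeLeaf delta1 mixedDeriv decay510_of_tendsto)
open Literature.MathematicalPhysics.QuantumFieldTheory.Balaban1983to89.B12Decay510Gauge (abs_twoPoint_le_of_gauge)
open Literature.MathematicalPhysics.QuantumFieldTheory.Balaban1983to89.B12Eq435SecondVariation (ofReal_fderiv_fderiv_eq_sum_mixedDeriv_of_repr)
open Literature.MathematicalPhysics.QuantumFieldTheory.Balaban1983to89.Beta.RemainderLocality (mixedDeriv_comp_clm)
open Summit.QuantumFields.YangMills.Theorems.K0RecordFormatNames (ΦfOf pvolOf plimOf)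
open Summit.QuantumFields.YangMills.Theorems.BalabanUVNodesPortS1 (ward414_of_gaugeInv119_chart44D)

variable (F : T4Family) {𝔄 : Type} [NormedRing 𝔄] [NormedAlgebra ℝ 𝔄] {V : Type} [NormedAddCommGroup V] [NormedSpace ℝ V] {ι : Type} [Fintype ι]
  (fam : TermFamily1 F 𝔄) (ρ : V →L[ℝ] 𝔄) (bV : Module.Basis ι ℝ V) (aStar : ι) (k : ℕ) (v : Fin (k + 1) → ℝ)
  {S : ℕ → LocDomainSys} {M m : ℕ → ℕ}

/-- **The cut `cutTo cX` as a continuous linear map** (input-locality of the charted pieces lets the responses be cut to `X`). [cite: Balaban1987RG1, (1.7) p.261, (4.35) p.290 (bookkeeping)] -/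
theorem exists_cutTo_clm {m₁ : ℕ} (cX : Finset (Fin m₁)) :
    ∃ T : (Fin m₁ → ℂ) →L[ℂ] (Fin m₁ → ℂ), ∀ u, T u = cutTo cX u := by
  classical
  refine ⟨LinearMap.toContinuousLinearMap
    { toFun := cutTo cX
      map_add' := fun u w => by ext i; simp only [cutTo_apply, Pi.add_apply]; split_ifs <;> simp
      map_smul' := fun c u => by ext i; simp only [cutTo_apply, Pi.smul_apply, RingHom.id_apply]; split_ifs <;> simp }, fun u => rfl⟩

/-- ★ **(4.37) AT A REAL HISTORY, PER VOLUME**: under the (1.19)-mould for the functional `ΦfOf F fam ρ k v (K n)`, the chart on a (4.4)-domain, the Ward ingredients, the (A3)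
cut-locality, RowL and RowS, the finite-volume kernel `pvolOf … (K n) 0 1 z` IS the kernel sum `Σ_X Re ∂²(𝐄ₙ(X)∘χ_X)[hₙ(X, e 1 0), hₙ(X, e 0 z)]` on the CUT responses —
(4.6) at n = 2 with (4.14) (`B12Eq435SecondVariation`) + (1.7). [cite: Balaban1987RG1, (4.35) p.290, (4.37) p.291, (1.20) p.264, (1.7) p.261] -/
theorem pvolOf_eq_sum_re_mixedDeriv (Uc : (n : ℕ) → (S n).Dom → Set (Fin (M n) → ℂ)) (coords : (n : ℕ) → (S n).Dom → Finset (Fin (M n)))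
    (χ : (n : ℕ) → (S n).Dom → (Fin (m n) → ℂ) → (Fin (M n) → ℂ)) (D : (n : ℕ) → (S n).Dom → Set (Fin (m n) → ℂ))
    (E : Pieces S M) (R : Response9Data S M m 4) (K : ℕ → ℕ)
    (ιe : (n : ℕ) → (Fin (F.P (K n)).d → Site (F.P (K n)) (k + 1) → V) → (Fin (m n) → ℂ))
    (hAn : Analytic19 Uc E) (hLoc : Local17 coords E) (hRep : Repr17 S E χ (fun n => ΦfOf F fam ρ k v (K n)) ιe) (hW : Ward414 χ E)
    (hC : Chart44D S M Uc m χ D) (hcut : ∀ n X u, ∀ i ∈ coords n X, χ n X (cutTo (R.cX n X) u) i = χ n X u i)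
    (hL : ∀ n, ιe n 0 = 0 ∧ ContDiffAt ℝ 2 (ιe n) 0 ∧ ∀ (μ : Fin 4) (z : Fin 4 → ℤ),
      R.Gk n (R.e n μ z) = fderiv ℝ (ιe n) 0 (Pi.single (Fin.cast (F.P_d (K n)).symm μ) (Pi.single (siteOfInt F (K n) (k + 1) z) (bV aStar))))
    (hS : ∀ (n : ℕ) (z : Fin 4 → ℤ), pvolOf F fam ρ bV k v (K n) 0 1 z =
      B12PolarizationTensor120.polComp ℝ (B12PolarizationTensor120.expChart (fam k v (K n)) ρ) bV (Fin.cast (F.P_d (K n)).symm 0)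
        (siteOfInt F (K n) (k + 1) z) aStar (Fin.cast (F.P_d (K n)).symm 1) (siteOfInt F (K n) (k + 1) 0) aStar)
    (n : ℕ) (z : Fin 4 → ℤ) :
    pvolOf F fam ρ bV k v (K n) 0 1 z =
      ∑ X, (mixedDeriv (fun u => E n X (χ n X u)) (cutTo (R.cX n X) (R.Gk n (R.e n 1 0))) (cutTo (R.cX n X) (R.Gk n (R.e n 0 z)))).re := by
  classical
  obtain ⟨hι0, hιC2, hGk⟩ := hL n
  -- the charted pieces are analytic at the chart origin
  have hF : ∀ X, AnalyticAt ℂ (fun u => E n X (χ n X u)) 0 := fun X => by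
    obtain ⟨-, -, -, h0, hχan, hmaps⟩ := hC n X
    exact (hAn n X (χ n X 0) (hmaps h0)).comp (hχan 0 h0)
  -- the representation of the (real) functional through `ℂ`
  have hrepr : (fun B => ((B12PolarizationTensor120.expChart (fam k v (K n)) ρ B : ℝ) : ℂ)) =ᶠ[𝓝 0]
      fun B => ∑ X, (fun u => E n X (χ n X u)) (ιe n B) := hRep n
  -- the bridge: `(D²expChart(0)[p][q] : ℂ) = Σ_X ∂²F_X[Dιe q, Dιe p]`
  set p : Fin (F.P (K n)).d → Site (F.P (K n)) (k + 1) → V := Pi.single (Fin.cast (F.P_d (K n)).symm 0) (Pi.single (siteOfInt F (K n) (k + 1) z) (bV aStar)) with hp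
  set q : Fin (F.P (K n)).d → Site (F.P (K n)) (k + 1) → V := Pi.single (Fin.cast (F.P_d (K n)).symm 1) (Pi.single (siteOfInt F (K n) (k + 1) 0) (bV aStar)) with hq
  have hbridge := (ofReal_fderiv_fderiv_eq_sum_mixedDeriv_of_repr (fun X u => E n X (χ n X u)) (ιe n) _ hrepr hι0 hιC2 hF (hW n) p q).2
  -- `pvolOf` is that second derivative (RowS + the definition of `polComp`)
  have hpv : (pvolOf F fam ρ bV k v (K n) 0 1 z : ℂ) = ∑ X, mixedDeriv (fun u => E n X (χ n X u)) (fderiv ℝ (ιe n) 0 q) (fderiv ℝ (ιe n) 0 p) := by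
    rw [hS n z]; exact hbridge
  -- RowL: the responses at the two window labels
  rw [← hGk 1 0] at hpv
  rw [← hGk 0 z] at hpv
  -- the cut: `F_X ∘ cutTo = F_X` by (A3) + (1.7)
  have hcutEq : ∀ X (a b : Fin (m n) → ℂ), mixedDeriv (fun u => E n X (χ n X u)) a b =
      mixedDeriv (fun u => E n X (χ n X u)) (cutTo (R.cX n X) a) (cutTo (R.cX n X) b) := by
    intro X a b
    obtain ⟨T, hT⟩ := exists_cutTo_clm (R.cX n X)
    have hfun : (fun u => E n X (χ n X u)) = fun u => (fun u => E n X (χ n X u)) (T u) := by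
      funext u; rw [hT]; exact (hLoc n X _ _ fun i hi => (hcut n X u i hi)).symm
    obtain ⟨r, hr, hball⟩ : ∃ r > 0, ∀ y ∈ Metric.ball (0 : Fin (m n) → ℂ) r, DifferentiableAt ℂ (fun u => E n X (χ n X u)) y := by
      obtain ⟨s, hs, hsub⟩ := Metric.mem_nhds_iff.1 (hF X).eventually_analyticAt
      exact ⟨s, hs, fun y hy => (hsub hy).differentiableAt⟩
    conv_lhs => rw [hfun]
    rw [mixedDeriv_comp_clm hr hball T a b, hT, hT]
  have hsum : ∑ X, mixedDeriv (fun u => E n X (χ n X u)) (R.Gk n (R.e n 1 0)) (R.Gk n (R.e n 0 z)) =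
      ∑ X, mixedDeriv (fun u => E n X (χ n X u)) (cutTo (R.cX n X) (R.Gk n (R.e n 1 0))) (cutTo (R.cX n X) (R.Gk n (R.e n 0 z))) :=
    Finset.sum_congr rfl fun X _ => hcutEq X _ _
  rw [hsum] at hpv
  -- take real parts
  have := congrArg Complex.re hpv
  rw [Complex.ofReal_re, Complex.re_sum] at this
  exact this

/-- ★★ **THE DECAY ROAD, ASSEMBLED OVER THE ROWS**: (1.19)-mould for `ΦfOf F fam ρ k v (K ·)` at ONE real history ∧ `Chart44D` ∧ chart equivariance ∧ «G semisimple» ∧ (A3)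
cut-locality ∧ `Response9D` (gauge currency) ∧ leaves with uniform letters ∧ window isometry ∧ RowL ∧ RowS ∧ (1.21) ⟹ (5.10) for the limit kernel:
`Decay510 (plimOf F fam ρ bV k v 0 1) (16·E₀·C₉²·e^{δ₁Mg c₁}·K₀·K₁) δ₁`, `δ₁ = ½ min{δ₀, κ∕Mg}`.  The constant reads the LETTERS only («absolute constants», p.263).
[cite: Balaban1987RG1, (5.10) p.293, (4.35)–(4.37) pp.290–291, (1.18)–(1.21) pp.263–264, (4.4)–(4.5) pp.281–282, (4.14) p.284; Balaban1985Variational, Prop. 9 p.309] -/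
theorem decay510_plimOf_of_rows (Uc : (n : ℕ) → (S n).Dom → Set (Fin (M n) → ℂ)) (coords : (n : ℕ) → (S n).Dom → Finset (Fin (M n)))
    (χ : (n : ℕ) → (S n).Dom → (Fin (m n) → ℂ) → (Fin (M n) → ℂ)) (D : (n : ℕ) → (S n).Dom → Set (Fin (m n) → ℂ))
    {Gg : ℕ → Type*} (act : (n : ℕ) → Gg n → (Fin (M n) → ℂ) → (Fin (M n) → ℂ)) {Hg : ℕ → Type*} (toG : (n : ℕ) → Hg n → Gg n)
    (A : (n : ℕ) → Hg n → ((Fin (m n) → ℂ) →L[ℂ] (Fin (m n) → ℂ))) (R : Response9Data S M m 4) (Nw K : ℕ → ℕ)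
    (ιe : (n : ℕ) → (Fin (F.P (K n)).d → Site (F.P (K n)) (k + 1) → V) → (Fin (m n) → ℂ))
    {E₀ κ C₉ δ₀ Mg c₁ K₀ K₁ : ℝ} (hE₀ : 0 ≤ E₀) (hκ : 0 ≤ κ) (hδ₀ : 0 ≤ δ₀) (hMg : 0 < Mg) (hK₀ : 0 ≤ K₀)
    (hA : FormatPlusG S M act Uc coords m χ (fun n => ΦfOf F fam ρ k v (K n)) ιe R.wrap R.emb R.πc E₀ κ)
    (hC : Chart44D S M Uc m χ D) (hEq : ChartEquivariant toG act χ A) (hN : ∀ n, NoInvariantCovector (A n))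
    (hcut : ∀ n X u, ∀ i ∈ coords n X, χ n X (cutTo (R.cX n X) u) i = χ n X u i)
    (hR : Response9D R χ Nw D C₉ δ₀)
    (hgeo : ∀ n, GeomLeaf (R.G n) (R.ρ n) Mg c₁) (hcube : ∀ n, CubeSumLeaf (R.G n) (δ₀ / 2) K₁) (htree : ∀ n, TreeLeaf (R.Cc n) (κ / 2) K₀)
    (hρ : ∀ (μ ν : Fin 4) (z : Fin 4 → ℤ), ∀ᶠ n in atTop, R.ρ n (R.e n μ 0) (R.e n ν z) = B12Sec2to5.l1 z)
    (hL : ∀ n, ιe n 0 = 0 ∧ ContDiffAt ℝ 2 (ιe n) 0 ∧ ∀ (μ : Fin 4) (z : Fin 4 → ℤ),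
      R.Gk n (R.e n μ z) = fderiv ℝ (ιe n) 0 (Pi.single (Fin.cast (F.P_d (K n)).symm μ) (Pi.single (siteOfInt F (K n) (k + 1) z) (bV aStar))))
    (hS : ∀ (n : ℕ) (z : Fin 4 → ℤ), pvolOf F fam ρ bV k v (K n) 0 1 z =
      B12PolarizationTensor120.polComp ℝ (B12PolarizationTensor120.expChart (fam k v (K n)) ρ) bV (Fin.cast (F.P_d (K n)).symm 0)
        (siteOfInt F (K n) (k + 1) z) aStar (Fin.cast (F.P_d (K n)).symm 1) (siteOfInt F (K n) (k + 1) 0) aStar)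
    (hLim : Limit121 (fun n => pvolOf F fam ρ bV k v (K n)) (plimOf F fam ρ bV k v)) :
    B12Sec2to5.Decay510 (plimOf F fam ρ bV k v 0 1) (16 * E₀ * C₉ ^ 2 * Real.exp (delta1 δ₀ κ Mg * Mg * c₁) * K₀ * K₁) (delta1 δ₀ κ Mg) := by
  obtain ⟨E, hAn, hB, hLoc, hRep, -, hG⟩ := hA
  have hW : Ward414 χ E := ward414_of_gaugeInv119_chart44D hG hEq hC hAn hN
  have hC₉ : 0 ≤ C₉ := hR.consts_nonneg.1
  refine decay510_of_tendsto (fun n z => pvolOf F fam ρ bV k v (K n) 0 1 z) (fun z => hLim 0 1 z) fun z => ?_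
  filter_upwards [hρ 1 0 z] with n hn
  -- (4.37) at this volume
  rw [pvolOf_eq_sum_re_mixedDeriv F fam ρ bV aStar k v Uc coords χ D E R K ιe hAn hLoc hRep hW hC hcut hL hS n z, ← hn]
  -- the per-volume (5.10) bound in gauge currency
  have hD : ∀ X : (S n).Dom, Convex ℝ (D n X) ∧ Balanced ℂ (D n X) ∧ IsOpen (D n X) ∧ (0 : Fin (m n) → ℂ) ∈ D n X := fun X => by
    obtain ⟨h1, h2, h3, h4, -, -⟩ := hC n X; exact ⟨h1, h2, h3, h4⟩
  have han : ∀ X : (S n).Dom, AnalyticOnNhd ℂ (fun u => E n X (χ n X u)) (D n X) := fun X w hw => by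
    obtain ⟨-, -, -, -, hχan, hmaps⟩ := hC n X
    exact (hAn n X (χ n X w) (hmaps hw)).comp (hχan w hw)
  have h118 : ∀ X : (S n).Dom, ∀ w ∈ D n X, ‖E n X (χ n X w)‖ ≤ E₀ * Real.exp (-κ * (S n).dj X) := fun X w hw => by
    obtain ⟨-, -, -, -, -, hmaps⟩ := hC n X
    exact (bound118_iff Uc E E₀ κ).1 hB n X _ (hmaps hw)
  exact abs_twoPoint_le_of_gauge (R.G n) (ρ := R.ρ n) (fun X u => E n X (χ n X u)) (D n) (fun X y => cutTo (R.cX n X) (R.Gk n y))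
    (fun X x y => (mixedDeriv (fun u => E n X (χ n X u)) (cutTo (R.cX n X) (R.Gk n x)) (cutTo (R.cX n X) (R.Gk n y))).re)
    hE₀ hC₉ hK₀ hδ₀ hκ hMg hD han h118 (fun _ _ _ => rfl) (fun X y => hR.decay n X y) (hgeo n) (hcube n) (htree n) _ _

end Summit.QuantumFields.YangMills.Theorems.PortH

end
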